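import Summits.ResolutionOfSingularities.ResolutionOfSingularities.Theorems.HomologicalConductorNoZenoRResolutionIsBlowup
import Summits.ResolutionOfSingularities.ResolutionOfSingularities.Theorems.HomologicalConductorNoZenoRGlobalResolutionBlowup
import Literature.AlgebraicGeometry.Resolution.NormalSurfaceSingularLocus
import Literature.AlgebraicGeometry.Resolution.Lipman1969RationalSurfaceSingularities
import Mathlib.RingTheory.KrullDimension.Field
import HarnessLib

/-!
# Crux `NoZenoR` (stmt-ResolutionOfSingularities-19943) — the EXISTENCE HALF of the W3 print `Lipman1969_4_1`
# (Lipman 1969, Thm. (4.1)) is a THEOREM: a normal surface with finitely many singular points whose local rings admit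
# desingularizations (e.g. rational singularities) has a desingularization — indeed one which is a blowing up along an
# ideal cosupported on the singular points

Route `ResolutionOfSingularities/HomologicalConductor` (cell decomp-res, hand leafhand-res-homologicalconduct-16 g4).
OURS: AI-written, weaker than expert review; SUPPORT level, counted 0; def-free, fact-free (no named fact is used).
Nothing here is a statement of the manuscript under review (Hironaka 2017); no crux / summit statement is proved, and the
print `Lipman1969_4_1` (which asks for the MINIMAL desingularization) is NOT discharged — only its existence clause.

Assembly of the two companion files:
* `…NoZenoRResolutionIsBlowup` (`exists_isResolution_isBlowup_support_subset_closedPoint`): a normal Noetherian local domain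
  of dimension `≤ 2` admitting a desingularization admits one which is the blowing up of an ideal cosupported at the closed
  point (Stacks 081T/080A/080B + principalization on regular surfaces);
* `…NoZenoRGlobalResolutionBlowup` (`exists_isResolution_isBlowup_of_local`): such local desingularizations at finitely many
  closed points globalise to a blowing up of `Y` (Temkin 2008 Lemma 2.1.1 + flat base change of blowing ups);
with the tree's normal-surface bookkeeping (`NormalSurfaceSingularLocus`: singular points of a normal surface are closed and
have two-dimensional local rings; points with local ring of dimension `≤ 1` are regular).

* `exists_isResolution_isBlowup_of_local_resolutions` — `Y` integral Noetherian with integrally closed local rings,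
  `dim Y ≤ 2`, `Sing Y` finite, every `Spec 𝒪_{Y,y}` (`y` singular) admitting a desingularization ⇒ a desingularization
  `Bl_J(Y) → Y` with `V(J) ⊆ Sing Y`;
* `exists_isResolution_of_hasRationalSingularity` — the same from `HasRationalSingularity 𝒪_{Y,y}` at the singular points;
* `Lipman1969_4_1_existence` — the existence clause of `Lipman1969_4_1` in its printed hypothesis block (the separatedness
  hypothesis of the print is not needed).

What remains of the print `Lipman1969_4_1` after this file: MINIMALITY of a suitable desingularization (every
desingularization of `Y` factors through it) — globally over `Y`; locally over `Spec 𝒪_{Y,y}` it is the tree's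
`exists_isMinimalResolution_of_27_1` (hands 16 g3 / 18 g1) modulo `Lipman1969_27_1_reg_rat`.
-/

noncomputable section

-- single-problem summit: the doubled namespace component `ResolutionOfSingularities` is forced
set_option linter.dupNamespace false

open CategoryTheory AlgebraicGeometry TopologicalSpace IsLocalRing
open Literature.AlgebraicGeometry.Resolution

universe u

namespace Summit.ResolutionOfSingularities.ResolutionOfSingularities.Theorems.NoZeno.SurfaceResolutionExistence

variable {Y : Scheme.{u}} [IsIntegral Y] [IsNoetherian Y]

omit [AlgebraicGeometry.IsNoetherian Y] in
/-- The generic point of an integral scheme is a regular point (its local ring is a field). [folklore] -/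
theorem genericPoint_mem_regularLocus : genericPoint Y ∈ Scheme.regularLocus Y := by
  rw [Scheme.mem_regularLocus]
  exact inferInstanceAs (IsRegularLocalRing Y.functionField)

/-- **Desingularization of a normal surface with finitely many, locally desingularizable, singular points** (`Y` integral
Noetherian with integrally closed local rings, `dim Y ≤ 2`, `Sing Y = Y ∖ Reg Y` finite, and `Spec 𝒪_{Y,y}` admitting a
desingularization for every singular `y`): there is a desingularization `f : X → Y` which is a blowing up along an ideal
sheaf `J` with `V(J) ⊆ Sing Y` (so `f` is an isomorphism over `Reg Y`). [this work] -/
theorem exists_isResolution_isBlowup_of_local_resolutions (hdim : topologicalKrullDim Y ≤ 2)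
    (hN : ∀ y : Y, IsIntegrallyClosed (Y.presheaf.stalk y)) (hfin : (Scheme.regularLocus Y)ᶜ.Finite)
    (hres : ∀ y ∈ (Scheme.regularLocus Y)ᶜ,
      ∃ (Xy : Scheme.{u}) (ρ : Xy ⟶ Spec (Y.presheaf.stalk y)), IsResolution ρ) :
    ∃ (X : Scheme.{u}) (f : X ⟶ Y) (J : Y.IdealSheafData),
      IsResolution f ∧ IsBlowup f J ∧ (J.support : Set Y) ⊆ (Scheme.regularLocus Y)ᶜ := by
  refine GlobalResolution.exists_isResolution_isBlowup_of_local (Scheme.regularLocus Y)ᶜ hfin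
    (fun y hy => isClosed_singleton_of_not_mem_regularLocus hN hdim hy)
    (fun h => h genericPoint_mem_regularLocus) (fun y hy => not_not.mp hy) fun y hy => ?_
  obtain ⟨Xy, ρ, hρ⟩ := hres y hy
  haveI : IsIntegrallyClosed (Y.presheaf.stalk y) := hN y
  have h2 : ringKrullDim (Y.presheaf.stalk y) ≤ 2 := (ringKrullDim_stalk_le_topologicalKrullDim Y y).trans hdim
  exact ResolutionIsBlowup.exists_isResolution_isBlowup_support_subset_closedPoint
    (S := Y.presheaf.stalk y) h2 hρ

/-- **Desingularization of a normal surface with finitely many rational singularities** — the existence clause of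
Lipman (4.1), print-free: `Y` integral Noetherian with integrally closed local rings, `dim Y ≤ 2`, `Sing Y` finite, and
`HasRationalSingularity 𝒪_{Y,y}` (Lipman Def. (1.1): some desingularization of `Spec 𝒪_{Y,y}` with `H¹(𝒪) = 0`) at every
singular point ⇒ a desingularization `Bl_J(Y) → Y`, `V(J) ⊆ Sing Y`.
[cite: Lipman1969, Theorem (4.1) (p. 204), existence clause] -/
theorem exists_isResolution_of_hasRationalSingularity (hdim : topologicalKrullDim Y ≤ 2)
    (hN : ∀ y : Y, IsIntegrallyClosed (Y.presheaf.stalk y)) (hfin : (Scheme.regularLocus Y)ᶜ.Finite)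
    (hrat : ∀ y ∈ (Scheme.regularLocus Y)ᶜ, HasRationalSingularity (Y.presheaf.stalk y)) :
    ∃ (X : Scheme.{u}) (f : X ⟶ Y) (J : Y.IdealSheafData),
      IsResolution f ∧ IsBlowup f J ∧ (J.support : Set Y) ⊆ (Scheme.regularLocus Y)ᶜ :=
  exists_isResolution_isBlowup_of_local_resolutions hdim hN hfin fun y hy => by
    obtain ⟨Xy, ρ, hρ, -⟩ := hrat y hy
    exact ⟨Xy, ρ, hρ⟩

/-- **Lipman 1969, Theorem (4.1) — EXISTENCE clause, as a theorem** in the exact hypothesis block of the print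
`Lipman1969_4_1` (`Y` integral Noetherian separated of dimension `2`, all local rings integrally closed, finitely many
singular points, all rational): `Y` has a desingularization.  (The print asks for the MINIMAL desingularization; that
clause is not proved here.) [cite: Lipman1969, Theorem (4.1) (p. 204), existence clause] -/
theorem Lipman1969_4_1_existence :
    ∀ (Y : Scheme.{u}) [IsIntegral Y] [IsNoetherian Y] [Y.IsSeparated],
      topologicalKrullDim Y = 2 → (∀ y : Y, IsIntegrallyClosed (Y.presheaf.stalk y)) →
      (Scheme.regularLocus Y)ᶜ.Finite →
      (∀ y ∈ (Scheme.regularLocus Y)ᶜ, HasRationalSingularity (Y.presheaf.stalk y)) →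
      ∃ (X : Scheme.{u}) (f : X ⟶ Y), IsResolution f := by
  intro Y _ _ _ hdim hN hfin hrat
  obtain ⟨X, f, -, hf, -, -⟩ := exists_isResolution_of_hasRationalSingularity hdim.le hN hfin hrat
  exact ⟨X, f, hf⟩

end Summit.ResolutionOfSingularities.ResolutionOfSingularities.Theorems.NoZeno.SurfaceResolutionExistence

end
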